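import Literature.Computability.Complexity.BrickAlgebra
import HarnessLib

/-!
# Clocked iteration with polynomially bounded iterates; counted loops whose rounds grow polynomially

Trunk `CplxCore`, a complement to `IterateFP.lean` (additive constant growth per round),
`IterateFPGrowth.lean` (growth `c (|x| + 1)` per round in the fixed first field `x`, through the
quadratic-size loop lemma `TM2Iter.iterate_of_sq`) and `BrickAlgebra.lean` (`Brick.loopFn_mem_FP`:
counted loops on records `⟨x, ⟨counter, state⟩⟩` with a body of linear growth). A loop whose
body is itself a counted loop — a matrix–vector product accumulated row by row, the inner loop
adding one scaled row — grows its state by a *polynomial* amount `G(|x|)` per round, which the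
linear-growth lemmas do not cover. The machine-level loop lemma
`TM2Iter.iterAux_outputsWithin_of_le` is stated for an arbitrary size bound, so nothing new is
needed at the machine level; this file lifts it in the polynomial regime:

* `PolyTimeComputable.iterate_of_poly`: if `|ea (F^[n] a)| ≤ B (|ea a| + n)` for a polynomial
  `B` then `(a, n) ↦ F^[n] a` is polynomial-time on `replicate n none ++ (ea a).map some`;
* `iterate_mem_FP_of_poly`: the `FP` string-function form, `z ↦ F^[p(|(boolUnpair z).1|)] z ∈ FP`;
* `iterate_mem_FP_of_growth_poly`: the sufficient condition — `F` keeps the first component `x`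
  of its pair-coded argument and grows the argument by at most `G(|x|)` per round;
* `Brick.loopFn_mem_FP_of_poly`: counted loops (`Brick.loopStep`) with a body of polynomial
  growth `|body z| ≤ |sndPow 1 z| + G(|fstF z|)` are in `FP` — so loop bricks nest.

## References

* S. Arora, B. Barak, *Computational Complexity: A Modern Approach*, CUP 2009, §1.4.1 (clocked
  simulation with a step counter), §1.3 (polynomial time is closed under bounded loops).
-/

namespace Literature.Computability.Complexity

open _root_.Computability Polynomial

namespace TM2Iter

/-- The running-time polynomial of the loop machine in the polynomial-size regime:
`3N + 4 + N · (2B + 3 + p B)` with `B = B(N)`. [folklore] -/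
noncomputable def iterPolyB (p B : Polynomial ℕ) : Polynomial ℕ :=
  3 * X + 4 + X * (2 * B + 3 + p.comp B)

/-- Evaluation of `iterPolyB`. [folklore] -/
theorem iterPolyB_eval (p B : Polynomial ℕ) (N : ℕ) :
    (iterPolyB p B).eval N = 3 * N + 4 + N * (2 * B.eval N + 3 + p.eval (B.eval N)) := by
  simp [iterPolyB, Polynomial.eval_comp]

/-- **Clocked iteration, polynomial-size form**: if the encoded iterates satisfy
`|ea (F^[n] a)| ≤ B (|ea a| + n)` for a polynomial `B`, then `(a, n) ↦ F^[n] a` is polynomial-time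
computable on `replicate n none ++ (ea a).map some` (the loop machine `TM2Iter.iterAux` with the
size bound `B (|ea a| + n)` in `TM2Iter.iterAux_outputsWithin_of_le`).
[cite: AroraBarak2009, §1.4.1 (universal TM with time bound)] -/
theorem _root_.Literature.Computability.Complexity.PolyTimeComputable.iterate_of_poly {α A : Type} [Inhabited A]
    {ea : α → List A} {F : α → α} (B : Polynomial ℕ)
    (hd : ∀ a n, (ea (F^[n] a)).length ≤ B.eval ((ea a).length + n))
    (hF : PolyTimeComputable ea ea F) :
    PolyTimeComputable (fun q : α × ℕ => List.replicate q.2 none ++ (ea q.1).map some) ea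
      (fun q => F^[q.2] q.1) := by
  obtain ⟨p, Mx, h⟩ := hF
  refine ⟨iterPolyB p B, iterAux Mx, fun q => ?_⟩
  obtain ⟨a, n⟩ := q
  set L := (ea a).length with hL
  have hB : ∀ i ≤ n, (ea (F^[i] a)).length ≤ B.eval (L + n) := fun i hi =>
    (hd a i).trans (eval_mono B (by omega))
  have hrun := iterAux_outputsWithin_of_le Mx p h a n (B.eval (L + n)) hB
  refine hrun.mono ?_
  dsimp only
  rw [List.length_append, List.length_map, List.length_replicate, iterPolyB_eval, ← hL]
  set N := n + L with hN
  have h1 : B.eval (L + n) = B.eval N := by rw [hN, Nat.add_comm n L]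
  rw [h1]
  have key : n * (2 * B.eval N + 3 + p.eval (B.eval N)) ≤ N * (2 * B.eval N + 3 + p.eval (B.eval N)) :=
    Nat.mul_le_mul_right _ (by omega)
  omega

end TM2Iter

/-- **Polynomially many rounds of an `FP` function with polynomially bounded iterates are in
`FP`.** If `F ∈ FP` and `|F^[n] z| ≤ B (|z| + n)` for all `z, n`, then for every polynomial `p`
the function `z ↦ F^[p(|(boolUnpair z).1|)] z` is in `FP` (clock layout `evalHdrFn`, recoding
`stageIt`, loop machine — as in `iterate_mem_FP`). [cite: AroraBarak2009, §1.4.1] -/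
theorem iterate_mem_FP_of_poly {F : List Bool → List Bool} (hF : F ∈ FP) (B : Polynomial ℕ)
    (hd : ∀ z n, (F^[n] z).length ≤ B.eval (z.length + n)) (p : Polynomial ℕ) :
    (fun z => F^[p.eval (boolUnpair z).1.length] z) ∈ FP := by
  have h3 : PolyTimeComputable (fun q : List Bool × ℕ => List.replicate q.2 none ++ (id q.1).map some)
      (id : List Bool → List Bool) (fun q => F^[q.2] q.1) :=
    PolyTimeComputable.iterate_of_poly (ea := (id : List Bool → List Bool)) B (fun w n => by simpa using hd w n) hF
  have h := PolyTimeComputable.comp_holds h3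
    (PolyTimeComputable.comp_holds polyTimeComputable_stageIt (evalHdrFn_mem_FP p))
  have heq : ((fun q : List Bool × ℕ => F^[q.2] q.1) ∘ stageIt ∘ evalHdrFn p) =
      fun z => F^[p.eval (boolUnpair z).1.length] z := by
    funext z
    simp [Function.comp_apply, evalHdrFn, stageIt_hdr]
  rw [heq] at h
  exact h

/-- Iterates of a round function that keeps the first component `x` of its pair-coded argument
and grows the argument by at most `G(|x|)` per round. [folklore] -/
theorem length_iterate_le_of_growth_poly {F : List Bool → List Bool} (G : Polynomial ℕ)
    (hfst : ∀ w, (boolUnpair (F w)).1 = (boolUnpair w).1)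
    (hd : ∀ w, (F w).length ≤ w.length + G.eval (boolUnpair w).1.length) (z : List Bool) (n : ℕ) :
    (F^[n] z).length ≤ z.length + n * G.eval (boolUnpair z).1.length := by
  have hx : ∀ n, (boolUnpair (F^[n] z)).1 = (boolUnpair z).1 := by
    intro n
    induction n with
    | zero => rfl
    | succ n ih => rw [Function.iterate_succ_apply', hfst, ih]
  induction n with
  | zero => simp
  | succ n ih =>
    rw [Function.iterate_succ_apply']
    have h1 := hd (F^[n] z)
    rw [hx n] at h1
    rw [Nat.succ_mul]
    omega

/-- **Polynomially many rounds of a first-component-preserving `FP` round function with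
polynomial growth are in `FP`.** If `F ∈ FP` keeps `x = (boolUnpair w).1` and
`|F w| ≤ |w| + G(|x|)`, then `z ↦ F^[p(|x|)] z ∈ FP` for every polynomial `p`.
[cite: AroraBarak2009, §1.4.1] -/
theorem iterate_mem_FP_of_growth_poly {F : List Bool → List Bool} (hF : F ∈ FP) (G : Polynomial ℕ)
    (hfst : ∀ w, (boolUnpair (F w)).1 = (boolUnpair w).1)
    (hd : ∀ w, (F w).length ≤ w.length + G.eval (boolUnpair w).1.length) (p : Polynomial ℕ) :
    (fun z => F^[p.eval (boolUnpair z).1.length] z) ∈ FP := by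
  refine iterate_mem_FP_of_poly hF (X + X * G) (fun z n => ?_) p
  have h := length_iterate_le_of_growth_poly G hfst hd z n
  have hx : (boolUnpair z).1.length ≤ z.length := length_boolUnpair_fst_le z
  have h2 : n * G.eval (boolUnpair z).1.length ≤ (z.length + n) * G.eval (z.length + n) :=
    Nat.mul_le_mul (by omega) (TM2Iter.eval_mono G (by omega))
  simp only [eval_add, eval_mul, eval_X]
  omega

namespace Brick

/-- **Growth of one round, polynomial form**: if `|body z| ≤ |sndPow 1 z| + G(|fstF z|)` on every
input, then `|loopStep body z| ≤ |z| + 4 (|fstF z| + 1) + G(|fstF z|)`. [folklore] -/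
theorem length_loopStep_le_poly {body : List Bool → List Bool} {G : Polynomial ℕ}
    (hbody : ∀ z, (body z).length ≤ (sndPow 1 z).length + G.eval (fstF z).length) (z : List Bool) :
    (loopStep body z).length ≤ z.length + (4 * ((fstF z).length + 1) + G.eval (fstF z).length) := by
  have h0 := length_fstF_sndF_le z
  have h1 := length_nthF_succ_add_sndPow_succ_le 0 z
  simp only [sndPow_zero] at h1
  rw [loopStep, iteFn_of_oneBit (oneBit_isNilFn.comp _)]
  split_ifs
  · rw [length_fanoutFn, length_fanoutFn]
    simp only [nthF_zero]
    nlinarith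
  · rw [length_fanoutFn, length_fanoutFn]
    simp only [nthF_zero]
    have hp : (predCntF z).length ≤ (nthF 1 z).length := by
      have : predCntF z = encodeNat (bitsToNat (nthF 1 z) - 1) := by simp [predCntF]
      rw [this]
      exact (length_encodeNat_mono (Nat.sub_le _ _)).trans (length_encodeNat_bitsToNat_le _)
    have hb := hbody z
    nlinarith

/-- **Counted loops with polynomially growing rounds are in `FP`**:
`z ↦ (loopStep body)^[p |fstF z|] z` for `body ∈ FP` with `|body z| ≤ |sndPow 1 z| + G(|fstF z|)`.
In particular a loop whose body is itself such a loop is again in `FP`.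
[cite: AroraBarak2009, §1.3 (bounded loops), §1.4.1] -/
theorem loopFn_mem_FP_of_poly {body : List Bool → List Bool} (h : body ∈ FP) (G : Polynomial ℕ)
    (hbody : ∀ z, (body z).length ≤ (sndPow 1 z).length + G.eval (fstF z).length) (p : Polynomial ℕ) :
    (fun z => (loopStep body)^[p.eval (fstF z).length] z) ∈ FP :=
  iterate_mem_FP_of_growth_poly (loopStep_mem_FP h) (4 * (X + 1) + G) (fun w => fstF_loopStep body w)
    (fun w => by
      change (loopStep body w).length ≤ w.length + (4 * (X + 1) + G).eval (fstF w).length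
      simpa using length_loopStep_le_poly hbody w) p

end Brick

end Literature.Computability.Complexity
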